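import Literature.NumberTheory.QuadraticFields.RealQuadraticClassNumberCycleCount
import Mathlib.NumberTheory.LegendreSymbol.JacobiSymbol
import HarnessLib

/-!
# The class number of a real quadratic field with all small primes inert — a certificate over PRIME norms only;
# (the deep rungs `D_67^+ … D_101^+` of the least-all-inert ladder)

Topic `NumberTheory/QuadraticFields`, namespace `Literature.NumberTheory.QuadraticFields` (sub-namespace `QuadIrr` for the
certificate, `Quadratic` for the field side); continues `RealQuadraticClassNumberCycleBound.lean` (`cycleEnumCert`: `h_K ≤ |R|`
by visiting EVERY reduced ideal `[a, (b + √D)/2]`, ≈ `D/4` candidate pairs) and `RealQuadraticClassNumberCycleCount.lean`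
(`cycleSepCert`: `|R| ≤ h_K`). Everything here is PROVED; the `def`s are computable `Bool`/`List` plumbing for the certificate.

THE POINT. Minkowski's bound (Mathlib `NumberField.exists_ideal_in_class_of_norm_le`) puts in every class an ideal of norm
`A ≤ √d_K/2`, and its Hermite form `(g)(A, ω − k)` is the REDUCED ideal `[A, (b + √D)/2]` after normalising `b`
(`Quadratic.exists_isReduced_mk0_eq` of `ReducedIdealsPerClass.lean`; here re-proved keeping the bound `(2A)² ≤ D`:
`exists_isReduced_mk0_eq_sq_le`). Since `4A ∣ D − b²`, every prime factor `p` of `A` has `(D/p) ≠ −1` and `A` is odd when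
`D ≡ 5 (mod 8)` (`jacobiSym_ne_neg_one_of_dvd`, `not_two_dvd_of_dvd_sub_sq`). Hence **if every prime `p ≤ y` is inert and
`⌊√D⌋/2 < (y+1)²`, then `A = 1` or `A` is a PRIME `> y`** (`eq_one_or_prime_of_inert`): the class group is exhausted by the
reduced ideals of prime norm `p ≤ ⌊√D⌋/2`, `p` split — for each such `p` exactly the `b ≡ ±β_p (mod p)` in the window
`⌊√D⌋ − 2p < b ≤ ⌊√D⌋`, `β_p² ≡ D (mod p)`. The certificate therefore needs ≈ `π(√D/2)` modular tests and table look-ups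
instead of ≈ `D/4` divisibility tests — decisive for `D ≈ 10⁸` (the rungs `44 401 013 … 261 153 653` of Lehmer–Lehmer–Shanks).

* `QuadIrr.smallOnCycle`, `QuadIrr.smallSet s h R` — the members `x` with `Q ≤ 2h` of the cycles (computable steps `cstep s`)
  through the listed `(r, ℓ) ∈ R` (first `ℓ` iterates), with `exists_of_mem_smallSet`;
* `QuadIrr.rootCands s a ρ` — the three integers `≡ ρ (mod a)` starting at the window `(⌊√D⌋ − 2a, ⌊√D⌋]` (`mem_rootCands`);
* `QuadIrr.normCheck D s W S a` — at a norm `a` with an entry `(a, β)` of the square-root table `W`: `β² ≡ D (mod a)` and every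
  candidate `b ∈ rootCands (±β)` that forms a reduced pair `(a, b)` (`pairOK`) has `(b + √D)/2a ∈ S`; without an entry: Euler's
  criterion `D^{(a−1)/2} ≡ −1 (mod a)` (no `b` at all when `a` is prime);
* **`QuadIrr.inertClassCert D s qs W R`** — `s = ⌊√D⌋`, the `r` of `R` pass `redIdealOK`, and for every `1 ≤ a ≤ s/2` either some
  `q ∈ qs` divides `a` or `normCheck` holds with `S = smallSet s (s/2) R`;
* **`Quadratic.classNumber_le_of_inertClassCert`**: `[K:ℚ] = 2`, `d_K = D ≡ 5 (mod 8)`, `(D/p) = −1` for all odd primes `p ≤ y`,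
  `s/2 < (y+1)²`, `qs ⊆ {2} ∪` {odd primes `≤ y`}, certificate `true` ⇒ `h_K ≤ |R|`;
  **`Quadratic.classNumber_eq_length_of_inertClassCert`** — with `cycleSepCert` for `R.map Prod.fst` as well, `h_K = |R|`.

* Rev 2 (append): STRICT twins `smallOnCycle'` / `smallSet'` / `inertClassCert'` — the test `Q ≤ 2h` is made in head
  position BEFORE recursing, so the kernel evaluates each cycle step as it goes (recursion depth `O(1)` per step) instead of
  accumulating `ℓ` deferred steps and forcing them at the end (depth `O(ℓ)`, which exceeded the gate's recursion limit at
  `ℓ ≈ 420` for `D = 261 153 653` although plain elaboration passed); `smallOnCycle'_eq`, `smallSet'_eq`, **`inertClassCert'_eq`**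
  (the twins compute the SAME values), so an instance states `inertClassCert … = true` (what the soundness theorem consumes) and
  proves it by `rw [← inertClassCert'_eq]; decide +kernel`; and RANGE SPLICING of the norm loop — `inertClassCertAuxFrom` (norms
  `lo + 1 … lo + n`), `inertClassCertAux_of_from`, `inertClassCert_of_pieces` — so that the loop over `a ≤ ⌊√D⌋/2` (≈ 10⁴ norms,
  ≈ 2 min of kernel time in one piece at `D = 2.6·10⁸`) is certified in several one-minute kernel declarations.

Instances (the five deep positive rungs `44 401 013`, `71 148 173`, `154 554 077`, `163 520 117`, `261 153 653`) are in
`RealQuadraticClassNumbersDeepRungsA–D.lean`. Not here: composite norms (not needed under the inert hypothesis), imaginary fields.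

## References

* [JacobsonWilliams2008] M. J. Jacobson, Jr., H. C. Williams, *Solving the Pell Equation*, CMS Books in Mathematics, Springer
  (2009), §3.3 (3.32), §5.1 Thm. 5.9 (an ideal of norm `< √Δ/2` is reduced), §5.3 Thm. 5.18.
* [Cohen1993] H. Cohen, *A Course in Computational Algebraic Number Theory*, GTM 138, §5.7 (class number of a real quadratic
  field by cycles), §1.5.1 (square roots mod `p`; Euler's criterion).
* [Marcus1977] D. A. Marcus, *Number Fields*, Ch. 5, Cor. 2 of Thm. 37 (the class group is generated by the primes of norm
  `≤ M_K`; inert primes contribute nothing).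
* [LehmerLehmerShanks1970] D. H. Lehmer, E. Lehmer, D. Shanks, Math. Comp. 24 (1970) 433–451, §1 (the discriminants with all
  small primes inert and their class numbers).
-/

noncomputable section

open Module NumberField

namespace Literature.NumberTheory.QuadraticFields

namespace QuadIrr

variable {D : ℕ}

/-! ### The certificate -/

/-- Prepend to `acc` those of the first `n` computable iterates `x, cstep x, …` that have `Q ≤ 2h` (norm `a = Q/2 ≤ h`).
[cite: JacobsonWilliams2008, §5.3 Thm. 5.18 (walking a cycle of reduced ideals)] -/
def smallOnCycle (s h : ℕ) : ℕ → QuadIrr D → List (QuadIrr D) → List (QuadIrr D)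
  | 0, _, acc => acc
  | n + 1, x, acc => smallOnCycle s h n (cstep s x) (if x.Q ≤ 2 * (h : ℤ) then x :: acc else acc)

/-- The members of norm `≤ h` of the listed cycles: for each `(r, ℓ) ∈ R` the first `ℓ` iterates of `r`.
[cite: JacobsonWilliams2008, §5.3 Thm. 5.18] -/
def smallSet (s h : ℕ) : List (QuadIrr D × ℕ) → List (QuadIrr D)
  | [] => []
  | rl :: R => smallOnCycle s h rl.2 rl.1 (smallSet s h R)

/-- The three integers `≡ ρ (mod a)` of the form `ρ mod a + a·j`, `j = j₀, j₀+1, j₀+2`, `j₀ = ⌊(s + 1 − 2a)/a⌋` — they contain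
every `b ≡ ρ (mod a)` of the window `s − 2a < b ≤ s` of a reduced pair `(a, b)`. [cite: JacobsonWilliams2008, §3.3 (3.32)] -/
def rootCands (s a ρ : ℕ) : List ℕ :=
  [ρ % a + a * ((s + 1 - 2 * a) / a), ρ % a + a * ((s + 1 - 2 * a) / a + 1), ρ % a + a * ((s + 1 - 2 * a) / a + 2)]

/-- One candidate `b` at the norm `a`: if `(a, b)` is a reduced pair (`pairOK`) then `(b + √D)/2a ∈ S`.
[cite: JacobsonWilliams2008, §5.3 Thm. 5.18] -/
def candOK (D a : ℕ) (S : List (QuadIrr D)) (b : ℕ) : Bool :=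
  !(pairOK D a b) || S.contains ⟨(b : ℤ), 2 * (a : ℤ)⟩

/-- The check at the norm `a` (used by the soundness proof only at `a = 1` or `a` prime): with a table entry `(a, β)`,
`β² ≡ D (mod a)` and all candidates `b ≡ ±β (mod a)` are `candOK`; without one, `1 < a` and Euler's criterion
`(D mod a)^{(a−1)/2} ≡ −1 (mod a)` («`a` inert»: no reduced ideal of norm `a`). [cite: Cohen1993, §1.5.1] -/
def normCheck (D s : ℕ) (W : List (ℕ × ℕ)) (S : List (QuadIrr D)) (a : ℕ) : Bool :=
  match W.lookup a with
  | some β => decide (β * β % a = D % a) &&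
      ((rootCands s a β).all (candOK D a S) && (rootCands s a (a - β % a)).all (candOK D a S))
  | none => decide (1 < a) && decide ((D % a) ^ ((a - 1) / 2) % a = a - 1)

/-- The loop over the norms `a = n, n − 1, …, 1`: each is divisible by some `q ∈ qs` (an inert prime) or passes `normCheck`.
[cite: Marcus1977, Ch. 5 Cor. 2 of Thm. 37] -/
def inertClassCertAux (D s : ℕ) (qs : List ℕ) (W : List (ℕ × ℕ)) (S : List (QuadIrr D)) : ℕ → Bool
  | 0 => true
  | n + 1 => ((qs.any fun q => (n + 1) % q == 0) || normCheck D s W S (n + 1)) && inertClassCertAux D s qs W S n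

/-- **The prime-norm class-number certificate**: `s² < D < (s+1)²`, every listed representative is reduced ideal-shaped
(`redIdealOK`), and every norm `1 ≤ a ≤ s/2` is dismissed by `qs` or checked by `normCheck` against the small members of the
listed cycles. [cite: JacobsonWilliams2008, §5.3 Thm. 5.18] -/
def inertClassCert (D s : ℕ) (qs : List ℕ) (W : List (ℕ × ℕ)) (R : List (QuadIrr D × ℕ)) : Bool :=
  decide (s * s < D) && decide (D < (s + 1) * (s + 1)) && (R.all fun rl => redIdealOK D rl.1) &&
    inertClassCertAux D s qs W (smallSet s (s / 2) R) (s / 2)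

/-! ### Soundness of the plumbing -/

/-- Members of `smallOnCycle s h n x acc` are iterates `cstep^[k] x`, `k < n`, or members of `acc`.
[cite: JacobsonWilliams2008, §5.3 Thm. 5.18] -/
theorem mem_smallOnCycle {s h : ℕ} : ∀ {n : ℕ} {x : QuadIrr D} {acc : List (QuadIrr D)} {y : QuadIrr D},
    y ∈ smallOnCycle s h n x acc → (∃ k < n, y = (cstep s)^[k] x) ∨ y ∈ acc
  | 0, _, _, _, hy => Or.inr hy
  | n + 1, x, acc, y, hy => by
    unfold smallOnCycle at hy
    rcases mem_smallOnCycle hy with ⟨k, hk, rfl⟩ | hmem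
    · exact Or.inl ⟨k + 1, by omega, by rw [Function.iterate_succ_apply]⟩
    · by_cases hQ : x.Q ≤ 2 * (h : ℤ)
      · rw [if_pos hQ, List.mem_cons] at hmem
        rcases hmem with rfl | hmem
        · exact Or.inl ⟨0, by omega, rfl⟩
        · exact Or.inr hmem
      · rw [if_neg hQ] at hmem
        exact Or.inr hmem

/-- Members of `smallSet s h R` lie on the listed cycles: `y = cstep^[k] r` with `(r, ℓ) ∈ R`, `k < ℓ`.
[cite: JacobsonWilliams2008, §5.3 Thm. 5.18] -/
theorem exists_of_mem_smallSet {s h : ℕ} : ∀ {R : List (QuadIrr D × ℕ)} {y : QuadIrr D},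
    y ∈ smallSet s h R → ∃ rl ∈ R, ∃ k < rl.2, y = (cstep s)^[k] rl.1
  | [], _, hy => by simp [smallSet] at hy
  | rl :: R, y, hy => by
    unfold smallSet at hy
    rcases mem_smallOnCycle hy with ⟨k, hk, hyk⟩ | hmem
    · exact ⟨rl, List.mem_cons_self, k, hk, hyk⟩
    · obtain ⟨rl', hrl', k, hk, hyk⟩ := exists_of_mem_smallSet hmem
      exact ⟨rl', List.mem_cons_of_mem _ hrl', k, hk, hyk⟩

/-- The window candidates are complete: `0 < a`, `2a ≤ s + 1`, `s + 1 − 2a ≤ b ≤ s`, `b ≡ ρ (mod a)` ⇒ `b ∈ rootCands s a ρ`.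
[cite: JacobsonWilliams2008, §3.3 (3.32)] -/
theorem mem_rootCands {s a ρ b : ℕ} (ha : 0 < a) (h2a : 2 * a ≤ s + 1) (hlo : s + 1 - 2 * a ≤ b) (hhi : b ≤ s)
    (hρ : b % a = ρ % a) : b ∈ rootCands s a ρ := by
  have hb : ρ % a + a * (b / a) = b := by rw [← hρ]; exact Nat.mod_add_div b a
  have hj₀ : (s + 1 - 2 * a) / a ≤ b / a := Nat.div_le_div_right hlo
  have hj₂ : b / a < (s + 1 - 2 * a) / a + 3 := by
    rw [Nat.div_lt_iff_lt_mul ha]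
    have h1 := Nat.div_add_mod (s + 1 - 2 * a) a
    have h2 := Nat.mod_lt (s + 1 - 2 * a) ha
    have h3 : ((s + 1 - 2 * a) / a + 3) * a = a * ((s + 1 - 2 * a) / a) + 3 * a := by ring
    omega
  simp only [rootCands, List.mem_cons, List.not_mem_nil, or_false]
  rcases Nat.lt_or_ge (b / a) ((s + 1 - 2 * a) / a + 1) with h | h
  · left; rw [show (s + 1 - 2 * a) / a = b / a by omega, hb]
  rcases Nat.lt_or_ge (b / a) ((s + 1 - 2 * a) / a + 2) with h' | h'
  · right; left; rw [show (s + 1 - 2 * a) / a + 1 = b / a by omega, hb]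
  · right; right; rw [show (s + 1 - 2 * a) / a + 2 = b / a by omega, hb]

/-- Soundness of the norm loop: every `1 ≤ a ≤ n` is dismissed or checked. [cite: Marcus1977, Ch. 5 Cor. 2 of Thm. 37] -/
theorem inertClassCertAux_sound {D s : ℕ} {qs : List ℕ} {W : List (ℕ × ℕ)} {S : List (QuadIrr D)} :
    ∀ {n : ℕ}, inertClassCertAux D s qs W S n = true → ∀ {a : ℕ}, 1 ≤ a → a ≤ n →
      (∃ q ∈ qs, q ∣ a) ∨ normCheck D s W S a = true
  | 0, _, a, h1, h2 => by omega
  | n + 1, h, a, h1, h2 => by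
    simp only [inertClassCertAux, Bool.and_eq_true, Bool.or_eq_true, List.any_eq_true, beq_iff_eq] at h
    rcases Nat.lt_succ_iff_lt_or_eq.1 (Nat.lt_succ_of_le h2) with hlt | rfl
    · exact inertClassCertAux_sound h.2 h1 (by omega)
    · rcases h.1 with ⟨q, hq, hqa⟩ | hn
      · exact Or.inl ⟨q, hq, Nat.dvd_of_mod_eq_zero hqa⟩
      · exact Or.inr hn

/-! ### Arithmetic of the norm of a Minkowski-reduced ideal under the inert hypothesis -/

/-- If an odd prime `p` divides `D − b²` (`b² ≤ D`) then `D` is a square mod `p`: `(D/p) ≠ −1`.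
[cite: Marcus1977, Ch. 3 Thm. 25] -/
theorem jacobiSym_ne_neg_one_of_dvd {p D b : ℕ} (hp : p.Prime) (hbD : b ^ 2 ≤ D) (h : p ∣ D - b ^ 2) :
    jacobiSym (D : ℤ) p ≠ -1 := by
  haveI : Fact p.Prime := ⟨hp⟩
  rw [← jacobiSym.legendreSym.to_jacobiSym, Ne, legendreSym.eq_neg_one_iff, not_not]
  obtain ⟨c, hc⟩ := h
  refine ⟨(b : ZMod p), ?_⟩
  have hD : D = b ^ 2 + p * c := by omega
  rw [Int.cast_natCast, hD]
  push_cast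
  rw [ZMod.natCast_self, zero_mul, add_zero, sq]

/-- If `2 ∣ a` and `4a ∣ D − b²` (`b² ≤ D`) then `D ≢ 5 (mod 8)` (squares are `0, 1, 4 mod 8`). [cite: Marcus1977, Ch. 3 Thm. 25] -/
theorem not_two_dvd_of_dvd_sub_sq {a D b : ℕ} (h8 : D % 8 = 5) (hbD : b ^ 2 ≤ D) (h : 4 * a ∣ D - b ^ 2) : ¬ 2 ∣ a := by
  rintro ⟨a', rfl⟩
  obtain ⟨c, hc⟩ := h
  have h4 : 4 * (2 * a') * c = 8 * (a' * c) := by ring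
  have hD : D = b ^ 2 + 8 * (a' * c) := by omega
  have hsq : b ^ 2 % 8 = 0 ∨ b ^ 2 % 8 = 1 ∨ b ^ 2 % 8 = 4 := by
    have hb8 : b % 8 < 8 := Nat.mod_lt b (by norm_num)
    rw [Nat.pow_mod]
    interval_cases (b % 8) <;> simp
  omega

/-- **The norm of a Minkowski-reduced ideal is `1` or a prime above `y`.** If `D ≡ 5 (mod 8)`, every odd prime `p ≤ y` has
`(D/p) = −1`, `4a ∣ D − b²` (`b² ≤ D`), and `0 < a < (y+1)²`, then `a = 1` or `a` is an (odd) prime with `y < a`.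
[cite: Marcus1977, Ch. 5 Cor. 2 of Thm. 37] -/
theorem eq_one_or_prime_of_inert {D y a b : ℕ} (h8 : D % 8 = 5)
    (hin : ∀ p : ℕ, p.Prime → p ≠ 2 → p ≤ y → jacobiSym (D : ℤ) p = -1) (hbD : b ^ 2 ≤ D) (hdvd : 4 * a ∣ D - b ^ 2)
    (ha0 : 0 < a) (hay : a < (y + 1) * (y + 1)) : a = 1 ∨ (a.Prime ∧ a ≠ 2 ∧ y < a) := by
  -- every prime factor of `a` is odd and `> y`
  have hfac : ∀ p : ℕ, p.Prime → p ∣ a → p ≠ 2 ∧ y < p := by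
    intro p hp hpa
    have hp2 : p ≠ 2 := by
      rintro rfl
      exact not_two_dvd_of_dvd_sub_sq h8 hbD hdvd hpa
    refine ⟨hp2, lt_of_not_ge fun hpy => ?_⟩
    exact jacobiSym_ne_neg_one_of_dvd hp hbD (dvd_trans (dvd_trans hpa (Dvd.intro_left 4 rfl)) hdvd) (hin p hp hp2 hpy)
  by_cases ha1 : a = 1
  · exact Or.inl ha1
  right
  have hp := Nat.minFac_prime ha1
  have hpa := Nat.minFac_dvd a
  obtain ⟨hp2, hyp⟩ := hfac _ hp hpa
  obtain ⟨m, hm⟩ := hpa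
  by_cases hm1 : m = 1
  · rw [hm1, mul_one] at hm
    rw [hm]
    exact ⟨hp, hp2, hyp⟩
  · exfalso
    have hm0 : m ≠ 0 := by rintro rfl; rw [mul_zero] at hm; omega
    have hq := Nat.minFac_prime hm1
    obtain ⟨-, hyq⟩ := hfac _ hq (dvd_trans (Nat.minFac_dvd m) (Dvd.intro_left a.minFac hm.symm))
    have h1 : (y + 1) * (y + 1) ≤ a.minFac * m.minFac := Nat.mul_le_mul (by omega) (by omega)
    have h2 : a.minFac * m.minFac ≤ a.minFac * m := Nat.mul_le_mul_left _ (Nat.minFac_le (Nat.pos_of_ne_zero hm0))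
    omega

/-- In `ZMod p` (`p ≥ 2`): `(m : ZMod p) = −1 ⟺ m mod p = p − 1`. [cite: Cohen1993, §1.5.1] -/
private theorem natCast_zmod_eq_neg_one_iff {p : ℕ} (hp : 2 ≤ p) (m : ℕ) : ((m : ZMod p) = -1) ↔ m % p = p - 1 := by
  have : NeZero p := ⟨by omega⟩
  have e : ((p - 1 : ℕ) : ZMod p) = -1 := by
    rw [Nat.cast_sub (by omega), ZMod.natCast_self, Nat.cast_one, zero_sub]
  rw [← e, ZMod.natCast_eq_natCast_iff, Nat.ModEq, Nat.mod_eq_of_lt (by omega : p - 1 < p)]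

/-- **Euler's criterion, computable inert form**: for an odd prime `p`, `(D mod p)^{(p−1)/2} ≡ −1 (mod p)` gives `(D/p) = −1`.
[cite: Cohen1993, §1.5.1] -/
theorem jacobiSym_eq_neg_one_of_pow {p D : ℕ} (hp : p.Prime) (hp2 : p ≠ 2) (h : (D % p) ^ ((p - 1) / 2) % p = p - 1) :
    jacobiSym (D : ℤ) p = -1 := by
  haveI : Fact p.Prime := ⟨hp⟩
  have h2p : 2 < p := lt_of_le_of_ne hp.two_le (Ne.symm hp2)
  have hpow : ((D : ℤ) : ZMod p) ^ (p / 2) = -1 := by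
    have e : (p - 1) / 2 = p / 2 := by
      obtain ⟨k, hk⟩ := hp.odd_of_ne_two hp2
      omega
    rw [← (natCast_zmod_eq_neg_one_iff hp.two_le _).mpr h, e, Int.cast_natCast, Nat.cast_pow, ZMod.natCast_mod]
  rw [← jacobiSym.legendreSym.to_jacobiSym]
  have key := legendreSym.eq_pow p (D : ℤ)
  have ha : ((D : ℤ) : ZMod p) ≠ 0 := by
    intro h0
    rw [h0, zero_pow (Nat.div_pos hp.two_le two_pos).ne'] at hpow
    exact (neg_ne_zero.mpr (one_ne_zero (α := ZMod p))) hpow.symm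
  rcases legendreSym.eq_one_or_neg_one p ha with h1 | h1
  · exfalso
    rw [h1, hpow] at key
    push_cast at key
    haveI : Fact (2 < p) := ⟨h2p⟩
    exact ZMod.neg_one_ne_one key.symm
  · exact h1

end QuadIrr

/-! ### Minkowski's representative keeps the bound `(2A)² ≤ D` -/

namespace Quadratic

open QuadIrr Literature.Computability.Cryptography
open scoped nonZeroDivisors NumberField

section Field

variable {K : Type*} [Field K] [NumberField K]
variable (b : Basis (Fin 2) ℤ (𝓞 K)) (hb : b 0 = 1) {t n : ℤ} (hω : b 1 * b 1 = (n : 𝓞 K) + (t : 𝓞 K) * b 1)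
variable {D : ℕ} (hDt : (D : ℤ) = t ^ 2 + 4 * n)

include hb hω hDt in
/-- **Every ideal class contains the ideal of a reduced ideal-shaped quotient of norm `≤ √D/2`**: as
`exists_isReduced_mk0_eq` (Minkowski `N𝔞 ≤ √D/2`, Hermite form `(g)(A, ω − k)`, `normalize`), keeping the conclusion
`Q² = (2A)² ≤ D`. [cite: JacobsonWilliams2008, §5.1 Thm. 5.9 (3)] -/
theorem exists_isReduced_mk0_eq_sq_le (hD : ¬ IsSquare D) (h2 : finrank ℚ K = 2)
    (hdisc : NumberField.discr K = D) (C : ClassGroup (𝓞 K)) :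
    ∃ x : QuadIrr D, x.IsIdealShaped ∧ x.IsReduced ∧ x.Q * x.Q ≤ (D : ℤ) ∧
      ∃ hI : Ideal.span {((fa x : ℤ) : 𝓞 K), b 1 - (((t - x.P) / 2 : ℤ) : 𝓞 K)} ∈ (Ideal (𝓞 K))⁰,
        ClassGroup.mk0 ⟨_, hI⟩ = C := by
  -- adapted from `ReducedIdealsPerClass.exists_isReduced_mk0_eq`, recording `2A ≤ √D`
  have hD0 : D ≠ 0 := by rintro rfl; exact hD ⟨0, rfl⟩
  have hd : 0 < NumberField.discr K := by rw [hdisc]; exact_mod_cast Nat.pos_of_ne_zero hD0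
  obtain ⟨I, hIC, hIN⟩ := NumberField.exists_ideal_in_class_of_norm_le C
  obtain ⟨-, hc0⟩ := nrRealPlaces_eq_two_and_nrComplexPlaces_eq_zero h2 hd
  rw [hc0, h2, hdisc] at hIN
  have hIN' : (Ideal.absNorm (I : Ideal (𝓞 K)) : ℝ) ≤ Real.sqrt D / 2 := by
    have habs : |((D : ℤ) : ℝ)| = (D : ℝ) := by push_cast; exact abs_of_nonneg (Nat.cast_nonneg _)
    rw [habs, Nat.factorial_two, pow_zero, one_mul] at hIN
    refine hIN.trans (le_of_eq ?_)
    norm_num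
    ring
  have hI0 : (I : Ideal (𝓞 K)) ≠ ⊥ := nonZeroDivisors.coe_ne_zero I
  obtain ⟨g, A, k, C', hg, hA, hAC, hIeq⟩ := exists_eq_span_singleton_mul_span_pair b hb hω hI0
  have hnorm : (A : ℝ) ≤ Ideal.absNorm (I : Ideal (𝓞 K)) := by
    have hg0 : Ideal.absNorm (Ideal.span {((g : ℤ) : 𝓞 K)}) ≠ 0 := by
      rw [Ne, Ideal.absNorm_eq_zero_iff, Ideal.span_singleton_eq_bot]
      intro h0
      have := intCast_eq_zero_of_basis b hb h0
      omega
    have h1 : Ideal.absNorm (I : Ideal (𝓞 K)) = Ideal.absNorm (Ideal.span {((g : ℤ) : 𝓞 K)}) * A.natAbs := by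
      rw [hIeq, map_mul, absNorm_span_pair_eq b hb hω hAC]
    have h2' : A.natAbs ≤ Ideal.absNorm (I : Ideal (𝓞 K)) := by
      rw [h1]; exact Nat.le_mul_of_pos_left _ (Nat.pos_of_ne_zero hg0)
    have h3 : ((A.natAbs : ℕ) : ℝ) = A := by
      rw [← Int.cast_natCast (R := ℝ), Int.natAbs_of_nonneg hA.le]
    rw [← h3]
    exact_mod_cast h2'
  have hle : ((2 * A : ℤ) : ℝ) ≤ Real.sqrt D := by push_cast; linarith
  have h2A : ((2 * A : ℤ) : ℝ) < Real.sqrt D := lt_of_le_of_ne hle (Ne.symm (sqrt_ne_intCast hD _))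
  have hsq : (2 * A) * (2 * A) ≤ (D : ℤ) := by
    have h00 : (0 : ℤ) ≤ 2 * A := by omega
    have h0 : (0 : ℝ) ≤ ((2 * A : ℤ) : ℝ) := by exact_mod_cast h00
    have h1 : ((2 * A : ℤ) : ℝ) * ((2 * A : ℤ) : ℝ) ≤ Real.sqrt D * Real.sqrt D :=
      mul_le_mul hle hle h0 (Real.sqrt_nonneg _)
    rw [Real.mul_self_sqrt (Nat.cast_nonneg _)] at h1
    exact_mod_cast h1
  set x' : QuadIrr D := ⟨t - 2 * k, 2 * A⟩ with hx'
  have hx's : x'.IsIdealShaped := by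
    refine ⟨show 0 < 2 * A by omega, ⟨A, rfl⟩, ⟨C', ?_⟩⟩
    show (t - 2 * k) ^ 2 - (D : ℤ) = 2 * (2 * A) * C'
    linear_combination (-1 : ℤ) * hDt + (-4 : ℤ) * hAC
  have hIx' : Ideal.span {((fa x' : ℤ) : 𝓞 K), b 1 - (((t - x'.P) / 2 : ℤ) : 𝓞 K)} =
      Ideal.span {(A : 𝓞 K), b 1 - k} := by
    show Ideal.span {(((2 * A) / 2 : ℤ) : 𝓞 K), b 1 - (((t - (t - 2 * k)) / 2 : ℤ) : 𝓞 K)} = _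
    rw [show (2 * A) / 2 = A by omega, show (t - (t - 2 * k)) / 2 = k by omega]
  have hn := InfraPrimitives.isIdealShaped_normalize hx's
  have hQn : (QuadIrr.normalize x').Q = 2 * A := rfl
  refine ⟨QuadIrr.normalize x', hn, isReduced_normalize hD hx's.isAdmissible hx's.1 h2A, by rw [hQn]; exact hsq,
    span_fa_mem_nonZeroDivisors b hb hn.1 hn.2.1, ?_⟩
  rw [← hIC, ClassGroup.mk0_eq_mk0_iff]
  refine ⟨(g : 𝓞 K), 1, ?_, one_ne_zero, ?_⟩
  · intro h0
    have := intCast_eq_zero_of_basis b hb h0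
    omega
  · show Ideal.span {((g : ℤ) : 𝓞 K)} * Ideal.span {((fa (QuadIrr.normalize x') : ℤ) : 𝓞 K),
        b 1 - (((t - (QuadIrr.normalize x').P) / 2 : ℤ) : 𝓞 K)} = Ideal.span {1} * (I : Ideal (𝓞 K))
    rw [span_fa_normalize b hDt hx's, hIx', Ideal.span_singleton_one, Ideal.top_mul, hIeq]

end Field

/-! ### The class number bound -/

section Bound

variable {K : Type*} [Field K] [NumberField K]

/-- **`h_K ≤` the number of listed cycles, by the prime-norm certificate.** If `[K:ℚ] = 2`, `d_K = D ≡ 5 (mod 8)`, `(D/p) = −1`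
for every odd prime `p ≤ y`, `⌊√D⌋/2 < (y+1)²`, every `q ∈ qs` is `2` or an odd prime `≤ y`, and `inertClassCert D s qs W R` holds, then
`classNumber K ≤ R.length`: the class of `C` is `[𝔞(x)]` with `x` reduced ideal-shaped of norm `a ≤ s/2`
(`exists_isReduced_mk0_eq_sq_le`); `a = 1` or a prime `> y` (`eq_one_or_prime_of_inert`); the certificate's `normCheck a`
then puts `x` (its `b` is `≡ ±β (mod a)`, in the window) in `smallSet`, i.e. on the cycle of some listed `r`, and
`[𝔞(x)] = [𝔞(r)]` (`mk0_span_fa_iterate`). [cite: JacobsonWilliams2008, §5.3 Thm. 5.18] -/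
theorem classNumber_le_of_inertClassCert (h2 : finrank ℚ K = 2) {D s y : ℕ} {qs : List ℕ} {W : List (ℕ × ℕ)}
    {R : List (QuadIrr D × ℕ)} (hdisc : NumberField.discr K = D) (h8 : D % 8 = 5)
    (hin : ∀ p : ℕ, p.Prime → p ≠ 2 → p ≤ y → jacobiSym (D : ℤ) p = -1) (hys : s / 2 < (y + 1) * (y + 1))
    (hqs : ∀ q ∈ qs, q = 2 ∨ (q.Prime ∧ q ≠ 2 ∧ q ≤ y)) (hcert : inertClassCert D s qs W R = true) :
    NumberField.classNumber K ≤ R.length := by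
  classical
  simp only [inertClassCert, Bool.and_eq_true, decide_eq_true_eq, List.all_eq_true] at hcert
  obtain ⟨⟨⟨hs1, hs2⟩, hR⟩, haux⟩ := hcert
  have hsq : s = Nat.sqrt D := Nat.eq_sqrt.mpr ⟨hs1.le, hs2⟩
  have hD : ¬ IsSquare D := fun ⟨r, hr⟩ => Nat.not_exists_sq hs1 hs2 ⟨r, hr.symm⟩
  have hred : ∀ rl ∈ R, rl.1.IsReduced ∧ rl.1.IsIdealShaped := fun rl hrl =>
    ⟨isReduced_of_redIdealOK (hR rl hrl), isIdealShaped_of_redIdealOK (hR rl hrl)⟩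
  obtain ⟨bK, hbK⟩ := exists_basis_zero_eq_one (K := K) h2
  set m : ℤ := bK.repr (bK 1 * bK 1) 0 with hm
  set t : ℤ := bK.repr (bK 1 * bK 1) 1 with ht
  have hω : bK 1 * bK 1 = (m : 𝓞 K) + (t : 𝓞 K) * bK 1 := basis_one_mul_self_eq bK hbK
  have hDt : (D : ℤ) = t ^ 2 + 4 * m := by rw [← hdisc]; exact discr_eq_sq_add_four_mul bK hbK
  let I : QuadIrr D → Ideal (𝓞 K) := fun r =>
    Ideal.span {((fa r : ℤ) : 𝓞 K), bK 1 - (((t - r.P) / 2 : ℤ) : 𝓞 K)}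
  have hI : ∀ i : Fin R.length, I (R.get i).1 ∈ (Ideal (𝓞 K))⁰ := fun i =>
    span_fa_mem_nonZeroDivisors bK hbK (t := t) (hred _ (List.get_mem R i)).2.1 (hred _ (List.get_mem R i)).2.2.1
  let g : Fin R.length → ClassGroup (𝓞 K) := fun i => ClassGroup.mk0 ⟨I (R.get i).1, hI i⟩
  suffices hg : Function.Surjective g by
    have hcard := Fintype.card_le_of_surjective g hg
    rw [Fintype.card_fin] at hcard
    exact hcard
  intro C
  obtain ⟨x, hs, hr, hQQ, hIx, hC⟩ := exists_isReduced_mk0_eq_sq_le bK hbK hω hDt hD h2 hdisc C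
  -- the integer pair `(a, b)` of `x`
  obtain ⟨ha0, hb0, hbD, hdvd, hlt, hor⟩ := hr.pair_spec hs
  obtain ⟨hfa, hP⟩ := hr.pair_cast hs
  set a := (fa x).toNat with ha
  set b := x.P.toNat with hb
  have hxeq : (⟨(b : ℤ), 2 * (a : ℤ)⟩ : QuadIrr D) = x := by
    refine QuadIrr.ext hP ?_
    show 2 * (a : ℤ) = x.Q
    rw [Q_eq_two_mul_fa hs, ← hfa]
  -- `2a ≤ s`, so `1 ≤ a ≤ s/2`, and the window `s + 1 − 2a ≤ b ≤ s`
  have h2as : 2 * a ≤ s := by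
    have hQ : x.Q = 2 * (a : ℤ) := by rw [Q_eq_two_mul_fa hs, ← hfa]
    rw [hQ] at hQQ
    have h4 : (2 * a) * (2 * a) ≤ D := by exact_mod_cast hQQ
    by_contra hlt'
    have : (s + 1) * (s + 1) ≤ (2 * a) * (2 * a) := Nat.mul_self_le_mul_self (by omega)
    omega
  have hbs : b ≤ s := by
    by_contra hlt'
    have : (s + 1) * (s + 1) ≤ b * b := Nat.mul_self_le_mul_self (by omega)
    have : b * b < D := by rw [← sq]; exact hbD
    omega
  have hlo : s + 1 - 2 * a ≤ b := by
    by_contra hlt'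
    have : (2 * a + b) * (2 * a + b) ≤ s * s := Nat.mul_self_le_mul_self (by omega)
    have : D < (2 * a + b) * (2 * a + b) := by rw [← sq]; exact hlt
    omega
  have hok : pairOK D a b = true := by
    simp only [pairOK, Bool.and_eq_true, decide_eq_true_eq, Bool.or_eq_true]
    refine ⟨⟨⟨⟨⟨ha0, hb0⟩, by rw [← sq]; exact hbD⟩, Nat.mod_eq_zero_of_dvd (by rw [← sq]; exact hdvd)⟩,
      by rw [← sq]; exact hlt⟩, ?_⟩
    rcases hor with hle | hlt2
    · exact Or.inl hle
    · exact Or.inr (by rw [← sq]; exact hlt2)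
  -- the certificate at the norm `a`
  rcases inertClassCertAux_sound haux ha0 (by omega) with ⟨q, hq, hqa⟩ | hnc
  · exfalso
    rcases hqs q hq with rfl | ⟨hqp, hq2, hqy⟩
    · exact not_two_dvd_of_dvd_sub_sq h8 hbD.le hdvd hqa
    · exact jacobiSym_ne_neg_one_of_dvd hqp hbD.le (dvd_trans (dvd_trans hqa (Dvd.intro_left 4 rfl)) hdvd)
        (hin q hqp hq2 hqy)
  have haP := eq_one_or_prime_of_inert h8 hin hbD.le hdvd ha0 (by omega)
  -- from `normCheck a`: `x ∈ smallSet`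
  have hmemS : x ∈ smallSet s (s / 2) R := by
    unfold normCheck at hnc
    split at hnc
    · rename_i β hβ
      simp only [Bool.and_eq_true, decide_eq_true_eq, List.all_eq_true] at hnc
      obtain ⟨hββ, hc1, hc2⟩ := hnc
      -- `b ≡ ±β (mod a)`
      have hba : b % a = β % a ∨ b % a = (a - β % a) % a := by
        rcases haP with ha1 | ⟨hap, -, -⟩
        · left; rw [ha1, Nat.mod_one, Nat.mod_one]
        · haveI : Fact a.Prime := ⟨hap⟩
          have h1 : ((b : ℕ) : ZMod a) ^ 2 = ((β : ℕ) : ZMod a) ^ 2 := by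
            have e1 : ((D : ℕ) : ZMod a) = ((b ^ 2 : ℕ) : ZMod a) := by
              rw [ZMod.natCast_eq_natCast_iff']
              obtain ⟨c, hc⟩ := hdvd
              have : D = b ^ 2 + a * (4 * c) := by rw [← mul_assoc, mul_comm a 4]; omega
              rw [this, Nat.add_mul_mod_self_left]
            have e2 : ((β * β : ℕ) : ZMod a) = ((D : ℕ) : ZMod a) := by
              rw [ZMod.natCast_eq_natCast_iff']; exact hββ
            push_cast at e1 e2 ⊢
            rw [← e1, ← e2, sq]
          rcases sq_eq_sq_iff_eq_or_eq_neg.mp h1 with h | h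
          · left
            exact (ZMod.natCast_eq_natCast_iff' _ _ _).mp h
          · right
            have h' : ((b : ℕ) : ZMod a) = ((a - β % a : ℕ) : ZMod a) := by
              rw [Nat.cast_sub (Nat.mod_lt β hap.pos).le, ZMod.natCast_self, zero_sub, ZMod.natCast_mod, h]
            exact (ZMod.natCast_eq_natCast_iff' _ _ _).mp h'
      have hcand : candOK D a (smallSet s (s / 2) R) b = true := by
        rcases hba with h | h
        · exact hc1 b (mem_rootCands ha0 (by omega) hlo hbs h)
        · exact hc2 b (mem_rootCands ha0 (by omega) hlo hbs h)
      simp only [candOK, hok, Bool.not_true, Bool.false_or, List.contains_iff_mem] at hcand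
      rwa [hxeq] at hcand
    · simp only [Bool.and_eq_true, decide_eq_true_eq] at hnc
      exfalso
      rcases haP with ha1 | ⟨hap, ha2, -⟩
      · omega
      · exact jacobiSym_ne_neg_one_of_dvd hap hbD.le (dvd_trans (Dvd.intro_left 4 rfl) hdvd)
          (jacobiSym_eq_neg_one_of_pow hap ha2 hnc.2)
  -- `x` lies on the cycle of a listed `r`
  obtain ⟨rl, hrl, k, -, hk⟩ := exists_of_mem_smallSet hmemS
  obtain ⟨i, hi⟩ := List.mem_iff_get.mp hrl
  refine ⟨i, ?_⟩
  have hrr := (hred rl hrl).1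
  have hrs := (hred rl hrl).2
  have hk' : x = step^[k] rl.1 := by rw [hk, iterate_step_eq_iterate_cstep hD hsq hrr k]
  have hsk := hrs.iterate hD hrr k
  have hIk := span_fa_mem_nonZeroDivisors bK hbK (t := t) hsk.1 hsk.2.1
  have hstep := mk0_span_fa_iterate bK hbK hω hDt hD k hrs hrr
    (span_fa_mem_nonZeroDivisors bK hbK (t := t) hrs.1 hrs.2.1) hIk
  rw [← hC]
  have e1 : ClassGroup.mk0 ⟨_, hIx⟩ = ClassGroup.mk0 ⟨_, hIk⟩ := by
    congr 1; exact Subtype.ext (by simp only [hk'])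
  rw [e1, hstep]
  show ClassGroup.mk0 ⟨I (R.get i).1, hI i⟩ = _
  congr 1
  exact Subtype.ext (by simp only [I, hi])

/-- **`h_K =` the number of listed cycles**, by the prime-norm certificate (`≤`) and the separation certificate of
`RealQuadraticClassNumberCycleCount` (`≥`, the representatives lie on distinct cycles). [cite: JacobsonWilliams2008, §5.3 Thm. 5.18] -/
theorem classNumber_eq_length_of_inertClassCert (h2 : finrank ℚ K = 2) {D s y n' : ℕ} {qs : List ℕ} {W : List (ℕ × ℕ)}
    {R : List (QuadIrr D × ℕ)} (hdisc : NumberField.discr K = D) (h8 : D % 8 = 5)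
    (hin : ∀ p : ℕ, p.Prime → p ≠ 2 → p ≤ y → jacobiSym (D : ℤ) p = -1) (hys : s / 2 < (y + 1) * (y + 1))
    (hqs : ∀ q ∈ qs, q = 2 ∨ (q.Prime ∧ q ≠ 2 ∧ q ≤ y)) (hcert : inertClassCert D s qs W R = true)
    (hsep : cycleSepCert D s n' (R.map Prod.fst) = true) : NumberField.classNumber K = R.length := by
  refine le_antisymm (classNumber_le_of_inertClassCert h2 hdisc h8 hin hys hqs hcert) ?_
  have h := length_le_classNumber_of_cycleSepCert h2 hdisc hsep
  rwa [List.length_map] at h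

end Bound

end Quadratic


/-! ### Rev 2 (append): strict twins of the cycle walk (bounded kernel recursion depth) -/

namespace QuadIrr

variable {D : ℕ}

/-- Strict twin of `smallOnCycle`: the test `Q ≤ 2h` on the CURRENT element is decided before the recursive call, so each step
of the walk is evaluated when it is taken. [cite: JacobsonWilliams2008, §5.3 Thm. 5.18] -/
def smallOnCycle' (s h : ℕ) : ℕ → QuadIrr D → List (QuadIrr D) → List (QuadIrr D)
  | 0, _, acc => acc
  | n + 1, x, acc =>
    if x.Q ≤ 2 * (h : ℤ) then smallOnCycle' s h n (cstep s x) (x :: acc) else smallOnCycle' s h n (cstep s x) acc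

/-- The strict walk computes the same list. [cite: JacobsonWilliams2008, §5.3 Thm. 5.18] -/
theorem smallOnCycle'_eq (s h : ℕ) : ∀ (n : ℕ) (x : QuadIrr D) (acc : List (QuadIrr D)),
    smallOnCycle' s h n x acc = smallOnCycle s h n x acc
  | 0, _, _ => rfl
  | n + 1, x, acc => by
    unfold smallOnCycle' smallOnCycle
    split <;> exact smallOnCycle'_eq s h n _ _

/-- Strict twin of `smallSet`. [cite: JacobsonWilliams2008, §5.3 Thm. 5.18] -/
def smallSet' (s h : ℕ) : List (QuadIrr D × ℕ) → List (QuadIrr D)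
  | [] => []
  | rl :: R => smallOnCycle' s h rl.2 rl.1 (smallSet' s h R)

/-- The strict small set is the small set. [cite: JacobsonWilliams2008, §5.3 Thm. 5.18] -/
theorem smallSet'_eq (s h : ℕ) : ∀ R : List (QuadIrr D × ℕ), smallSet' s h R = smallSet s h R
  | [] => rfl
  | rl :: R => by
    unfold smallSet' smallSet
    rw [smallSet'_eq s h R, smallOnCycle'_eq]

/-- Strict twin of the prime-norm certificate (same checks, strict cycle walk). [cite: JacobsonWilliams2008, §5.3 Thm. 5.18] -/
def inertClassCert' (D s : ℕ) (qs : List ℕ) (W : List (ℕ × ℕ)) (R : List (QuadIrr D × ℕ)) : Bool :=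
  decide (s * s < D) && decide (D < (s + 1) * (s + 1)) && (R.all fun rl => redIdealOK D rl.1) &&
    inertClassCertAux D s qs W (smallSet' s (s / 2) R) (s / 2)

/-- **The strict certificate IS the certificate**: `inertClassCert' D s qs W R = inertClassCert D s qs W R`; instances prove
`inertClassCert … = true` by `rw [← inertClassCert'_eq]; decide +kernel`. [cite: JacobsonWilliams2008, §5.3 Thm. 5.18] -/
theorem inertClassCert'_eq (D s : ℕ) (qs : List ℕ) (W : List (ℕ × ℕ)) (R : List (QuadIrr D × ℕ)) :
    inertClassCert' D s qs W R = inertClassCert D s qs W R := by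
  unfold inertClassCert' inertClassCert
  rw [smallSet'_eq]

/-- The norm loop over a RANGE: the norms `a = lo + n, lo + n − 1, …, lo + 1` (so that a long loop can be certified in several
kernel declarations). [cite: Marcus1977, Ch. 5 Cor. 2 of Thm. 37] -/
def inertClassCertAuxFrom (D s : ℕ) (qs : List ℕ) (W : List (ℕ × ℕ)) (S : List (QuadIrr D)) (lo : ℕ) : ℕ → Bool
  | 0 => true
  | n + 1 => ((qs.any fun q => (lo + n + 1) % q == 0) || normCheck D s W S (lo + n + 1)) &&
      inertClassCertAuxFrom D s qs W S lo n

/-- Splicing: the loop up to `lo` and the range loop `(lo, lo + n]` give the loop up to `lo + n`.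
[cite: Marcus1977, Ch. 5 Cor. 2 of Thm. 37] -/
theorem inertClassCertAux_of_from {D s : ℕ} {qs : List ℕ} {W : List (ℕ × ℕ)} {S : List (QuadIrr D)} {lo : ℕ} :
    ∀ {n : ℕ}, inertClassCertAux D s qs W S lo = true → inertClassCertAuxFrom D s qs W S lo n = true →
      inertClassCertAux D s qs W S (lo + n) = true
  | 0, h₁, _ => h₁
  | n + 1, h₁, h₂ => by
    simp only [inertClassCertAuxFrom, Bool.and_eq_true] at h₂
    show (((qs.any fun q => (lo + n + 1) % q == 0) || normCheck D s W S (lo + n + 1)) &&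
      inertClassCertAux D s qs W S (lo + n)) = true
    rw [Bool.and_eq_true]
    exact ⟨h₂.1, inertClassCertAux_of_from h₁ h₂.2⟩

/-- **Assembling the certificate from pieces**: the cheap header checks plus the norm loop (run with the strict small set, possibly
spliced from ranges by `inertClassCertAux_of_from`) give `inertClassCert … = true`. [cite: JacobsonWilliams2008, §5.3 Thm. 5.18] -/
theorem inertClassCert_of_pieces {D s : ℕ} {qs : List ℕ} {W : List (ℕ × ℕ)} {R : List (QuadIrr D × ℕ)}
    (h₀ : (decide (s * s < D) && decide (D < (s + 1) * (s + 1)) && (R.all fun rl => redIdealOK D rl.1)) = true)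
    (h : inertClassCertAux D s qs W (smallSet' s (s / 2) R) (s / 2) = true) : inertClassCert D s qs W R = true := by
  rw [← inertClassCert'_eq]
  unfold inertClassCert'
  rw [Bool.and_eq_true]
  exact ⟨h₀, h⟩

end QuadIrr

end Literature.NumberTheory.QuadraticFields

end
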